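import Mathlib.Topology.Covering.Basic
import Mathlib.Topology.Bases
import Mathlib.Topology.Homeomorph.Lemmas
import HarnessLib

/-!
# Filling the puncture of a covering map

Topic `Literature/Topology/CoveringSpaces` (general topology infrastructure; written for the cusps of
modular curves in the formalization of F. Calegari, V. Dimitrov, Y. Tang, *The unbounded
denominators conjecture*, J. Amer. Math. Soc. **38** (2025), arXiv:2109.09040, §3 Remark 16: "let
`Y'` denote the modular curve `Y` with all the cusps above `0 ∈ Y(2)` filled in. The fiber product
`Y' ×_{Y(2)} U` with its natural map to `U` is a covering map (one can check this claim locally; the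
assumption on cusp widths is used to prove that `0 ∈ U` is not ramified)").

**The construction.** Let `p : E → X`, `x₀ : X` and a family of "sheets" `U : ι → Set E`.
`PunctureFill p x₀ U` is `E` with one new point `∞ᵢ` ("the cusp at the end of the sheet `U i`")
adjoined for each `i`, topologized by the open sets of `E` together with the *cusp neighbourhoods*
`{∞ᵢ} ∪ (U i ∩ p⁻¹ O)`, `O` an open neighbourhood of `x₀` (`PunctureFill.basis`,
`PunctureFill.isTopologicalBasis`); `PunctureFill.proj` is `p` on `E` and `∞ᵢ ↦ x₀`.

**The theorem** (`PunctureFill.isCoveringMap_proj`). If `p` omits `x₀` and is a covering map over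
`X ∖ {x₀}`, and `x₀` has an open neighbourhood `W` such that `p ⁻¹ W` is the disjoint union of the
open sheets `U i`, each mapped by `p` bijectively onto `W ∖ {x₀}` ("`W ∖ {x₀}` is evenly covered,
by punctured sheets"), then `proj : PunctureFill p x₀ U → X` is a covering map: over `X ∖ {x₀}` it
is `p` (`isCoveringMapOn_proj_compl`, transport along the open embedding `inl`,
`isOpenEmbedding_inl`), and `W` is evenly covered with fibre `ι` by the sheets `{∞ᵢ} ∪ U i`
(`isEvenlyCovered_proj`, via Mathlib's `IsOpen.trivializationDiscrete`; the key point is that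
`proj` is open, `isOpenMap_proj`, because `proj({∞ᵢ} ∪ (U i ∩ p⁻¹O)) = W ∩ O`).

Also: `continuous_inl`, `continuous_proj`, `range_inl`, `nhds_inr_hasBasis`,
`continuousAt_inr_iff` (a map out of the filled space is continuous at `∞ᵢ` iff along the sheet
`U i` it tends to its value as `p → x₀`).

## References

* [CalegariDimitrovTang2025] arXiv:2109.09040, §3, Remark 16 (cusps filled in; covering of `U`).
* Folklore (e.g. O. Forster, *Lectures on Riemann Surfaces*, GTM 81, §8, Thm 8.4: extension of
  unbranched coverings of the punctured disc).
-/

open Set Filter Topology TopologicalSpace Function Bundle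

namespace Literature.Topology.CoveringSpaces

variable {E X ι : Type*}

/-- **Filling a puncture.** Given `p : E → X`, a point `x₀ : X` and a family of "sheets"
`U : ι → Set E` (intended: the sheets of `p` over a punctured neighbourhood `W ∖ {x₀}` of `x₀`,
each mapped homeomorphically onto `W ∖ {x₀}`), the space `E` with one new point `∞ᵢ` adjoined at
the end of each sheet `U i`. [folklore] -/
def PunctureFill (_p : E → X) (_x₀ : X) (_U : ι → Set E) : Type _ := E ⊕ ι

namespace PunctureFill

variable (p : E → X) (x₀ : X) (U : ι → Set E)

/-- The old points `E ↪ PunctureFill`. [folklore] -/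
def inl : E → PunctureFill p x₀ U := Sum.inl

/-- The new points `∞ᵢ`, one for each sheet. [folklore] -/
def inr : ι → PunctureFill p x₀ U := Sum.inr

/-- The projection `PunctureFill p x₀ U → X`: `p` on `E`, and `∞ᵢ ↦ x₀`. [folklore] -/
def proj : PunctureFill p x₀ U → X := Sum.elim p fun _ ↦ x₀

/-- `proj` on old points. [folklore] -/
@[simp] theorem proj_inl (e : E) : proj p x₀ U (inl p x₀ U e) = p e := rfl

/-- `proj` on new points. [folklore] -/
@[simp] theorem proj_inr (i : ι) : proj p x₀ U (inr p x₀ U i) = x₀ := rfl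

/-- `inl` is injective. [folklore] -/
theorem inl_injective : Function.Injective (inl p x₀ U) := Sum.inl_injective

/-- `inr` is injective. [folklore] -/
theorem inr_injective : Function.Injective (inr p x₀ U) := Sum.inr_injective

/-- Old and new points differ. [folklore] -/
theorem inl_ne_inr (e : E) (i : ι) : inl p x₀ U e ≠ inr p x₀ U i := Sum.inl_ne_inr

/-- Every point is old or new. [folklore] -/
theorem inl_or_inr (z : PunctureFill p x₀ U) : (∃ e, z = inl p x₀ U e) ∨ ∃ i, z = inr p x₀ U i := by
  rcases z with e | i
  · exact Or.inl ⟨e, rfl⟩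
  · exact Or.inr ⟨i, rfl⟩

variable [TopologicalSpace E] [TopologicalSpace X]

/-- The basic open sets: images of open sets of `E`, and the "cusp neighbourhoods"
`{∞ᵢ} ∪ (U i ∩ p⁻¹ O)` of the new points (`O` an open neighbourhood of `x₀`). [folklore] -/
def basis : Set (Set (PunctureFill p x₀ U)) :=
  {s | ∃ O : Set E, IsOpen O ∧ s = inl p x₀ U '' O} ∪
    {s | ∃ i, ∃ O : Set X, IsOpen O ∧ x₀ ∈ O ∧
      s = insert (inr p x₀ U i) (inl p x₀ U '' (U i ∩ p ⁻¹' O))}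

/-- The topology of the filled space, generated by `PunctureFill.basis`. [folklore] -/
instance topologicalSpace : TopologicalSpace (PunctureFill p x₀ U) :=
  generateFrom (basis p x₀ U)

variable {p x₀ U}

/-- Images of open sets of `E` are basic. [folklore] -/
theorem mem_basis_inl {O : Set E} (hO : IsOpen O) : inl p x₀ U '' O ∈ basis p x₀ U :=
  Or.inl ⟨O, hO, rfl⟩

/-- Cusp neighbourhoods are basic. [folklore] -/
theorem mem_basis_inr (i : ι) {O : Set X} (hO : IsOpen O) (hx : x₀ ∈ O) :
    insert (inr p x₀ U i) (inl p x₀ U '' (U i ∩ p ⁻¹' O)) ∈ basis p x₀ U :=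
  Or.inr ⟨i, O, hO, hx, rfl⟩

/-- Basic sets are open. [folklore] -/
theorem isOpen_of_mem_basis {s : Set (PunctureFill p x₀ U)} (hs : s ∈ basis p x₀ U) : IsOpen s :=
  isOpen_generateFrom_of_mem hs

/-- Images of open sets of `E` are open. [folklore] -/
theorem isOpen_image_inl {O : Set E} (hO : IsOpen O) : IsOpen (inl p x₀ U '' O) :=
  isOpen_of_mem_basis (mem_basis_inl hO)

/-- Cusp neighbourhoods are open. [folklore] -/
theorem isOpen_cuspNhd (i : ι) {O : Set X} (hO : IsOpen O) (hx : x₀ ∈ O) :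
    IsOpen (insert (inr p x₀ U i) (inl p x₀ U '' (U i ∩ p ⁻¹' O))) :=
  isOpen_of_mem_basis (mem_basis_inr i hO hx)

/-- The basic open sets form a basis of the topology (they are stable under intersection), when
the sheets are open and `p` is continuous. [folklore] -/
theorem isTopologicalBasis (hp : Continuous p) (hU : ∀ i, IsOpen (U i)) :
    IsTopologicalBasis (basis p x₀ U) := by
  refine ⟨?_, ?_, rfl⟩
  · rintro t₁ ht₁ t₂ ht₂ z ⟨hz₁, hz₂⟩
    rcases ht₁ with ⟨O₁, hO₁, rfl⟩ | ⟨i₁, O₁, hO₁, hx₁, rfl⟩ <;>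
      rcases ht₂ with ⟨O₂, hO₂, rfl⟩ | ⟨i₂, O₂, hO₂, hx₂, rfl⟩
    · refine ⟨inl p x₀ U '' (O₁ ∩ O₂), mem_basis_inl (hO₁.inter hO₂), ?_, ?_⟩
      · obtain ⟨e, he, rfl⟩ := hz₁
        obtain ⟨e', he', hee'⟩ := hz₂
        rw [(inl_injective p x₀ U) hee'] at he'
        exact ⟨e, ⟨he, he'⟩, rfl⟩
      · rw [image_inter (inl_injective p x₀ U)]
    · refine ⟨inl p x₀ U '' (O₁ ∩ (U i₂ ∩ p ⁻¹' O₂)),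
        mem_basis_inl (hO₁.inter ((hU i₂).inter (hO₂.preimage hp))), ?_, ?_⟩
      · obtain ⟨e, he, rfl⟩ := hz₁
        rcases hz₂ with h | ⟨e', he', hee'⟩
        · exact absurd h (inl_ne_inr p x₀ U e i₂)
        · rw [(inl_injective p x₀ U) hee'] at he'
          exact ⟨e, ⟨he, he'⟩, rfl⟩
      · rw [image_inter (inl_injective p x₀ U)]
        exact inter_subset_inter_right _ (subset_insert _ _)
    · refine ⟨inl p x₀ U '' ((U i₁ ∩ p ⁻¹' O₁) ∩ O₂),
        mem_basis_inl (((hU i₁).inter (hO₁.preimage hp)).inter hO₂), ?_, ?_⟩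
      · obtain ⟨e, he, rfl⟩ := hz₂
        rcases hz₁ with h | ⟨e', he', hee'⟩
        · exact absurd h (inl_ne_inr p x₀ U e i₁)
        · rw [(inl_injective p x₀ U) hee'] at he'
          exact ⟨e, ⟨he', he⟩, rfl⟩
      · rw [image_inter (inl_injective p x₀ U)]
        exact inter_subset_inter_left _ (subset_insert _ _)
    · by_cases hi : i₁ = i₂
      · subst hi
        refine ⟨insert (inr p x₀ U i₁) (inl p x₀ U '' (U i₁ ∩ p ⁻¹' (O₁ ∩ O₂))),
          mem_basis_inr i₁ (hO₁.inter hO₂) ⟨hx₁, hx₂⟩, ?_, ?_⟩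
        · rcases hz₁ with rfl | ⟨e, he, rfl⟩
          · exact mem_insert _ _
          · rcases hz₂ with h | ⟨e', he', hee'⟩
            · exact absurd h (inl_ne_inr p x₀ U e i₁)
            · rw [(inl_injective p x₀ U) hee'] at he'
              exact mem_insert_of_mem _ ⟨e, ⟨he.1, he.2, he'.2⟩, rfl⟩
        · intro w hw
          rcases hw with rfl | ⟨e, he, rfl⟩
          · exact ⟨mem_insert _ _, mem_insert _ _⟩
          · exact ⟨mem_insert_of_mem _ ⟨e, ⟨he.1, he.2.1⟩, rfl⟩,
              mem_insert_of_mem _ ⟨e, ⟨he.1, he.2.2⟩, rfl⟩⟩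
      · -- different cusps: the intersection contains no new point
        refine ⟨inl p x₀ U '' ((U i₁ ∩ p ⁻¹' O₁) ∩ (U i₂ ∩ p ⁻¹' O₂)),
          mem_basis_inl (((hU i₁).inter (hO₁.preimage hp)).inter ((hU i₂).inter (hO₂.preimage hp))),
          ?_, ?_⟩
        · rcases hz₁ with rfl | ⟨e, he, rfl⟩
          · rcases hz₂ with h | ⟨e', _, hee'⟩
            · exact absurd ((inr_injective p x₀ U) h) hi
            · exact absurd hee' (inl_ne_inr p x₀ U e' i₁)
          · rcases hz₂ with h | ⟨e', he', hee'⟩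
            · exact absurd h (inl_ne_inr p x₀ U e i₂)
            · rw [(inl_injective p x₀ U) hee'] at he'
              exact ⟨e, ⟨he, he'⟩, rfl⟩
        · rw [image_inter (inl_injective p x₀ U)]
          exact inter_subset_inter (subset_insert _ _) (subset_insert _ _)
  · apply eq_univ_of_forall
    intro z
    rcases inl_or_inr p x₀ U z with ⟨e, rfl⟩ | ⟨i, rfl⟩
    · exact ⟨_, mem_basis_inl isOpen_univ, e, mem_univ _, rfl⟩
    · exact ⟨_, mem_basis_inr i isOpen_univ (mem_univ _), mem_insert _ _⟩

/-- Open sets of the filled space, in terms of the basis. [folklore] -/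
theorem isOpen_iff (hp : Continuous p) (hU : ∀ i, IsOpen (U i)) {s : Set (PunctureFill p x₀ U)} :
    IsOpen s ↔ ∀ z ∈ s, ∃ t ∈ basis p x₀ U, z ∈ t ∧ t ⊆ s :=
  (isTopologicalBasis hp hU).isOpen_iff

/-- `inl ⁻¹'` of a basic open set is open. [folklore] -/
theorem isOpen_preimage_inl_of_mem_basis (hp : Continuous p) (hU : ∀ i, IsOpen (U i))
    {t : Set (PunctureFill p x₀ U)} (ht : t ∈ basis p x₀ U) : IsOpen (inl p x₀ U ⁻¹' t) := by
  rcases ht with ⟨O, hO, rfl⟩ | ⟨i, O, hO, -, rfl⟩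
  · rwa [preimage_image_eq _ (inl_injective p x₀ U)]
  · have : inl p x₀ U ⁻¹' insert (inr p x₀ U i) (inl p x₀ U '' (U i ∩ p ⁻¹' O)) = U i ∩ p ⁻¹' O := by
      rw [← union_singleton, preimage_union, preimage_image_eq _ (inl_injective p x₀ U)]
      have h0 : inl p x₀ U ⁻¹' {inr p x₀ U i} = ∅ :=
        eq_empty_of_forall_notMem fun e he ↦ inl_ne_inr p x₀ U e i he
      rw [h0, union_empty]
    rw [this]
    exact (hU i).inter (hO.preimage hp)

/-- `inl : E → PunctureFill` is continuous. [folklore] -/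
theorem continuous_inl (hp : Continuous p) (hU : ∀ i, IsOpen (U i)) :
    Continuous (inl p x₀ U) :=
  continuous_generateFrom_iff.mpr fun _ ht ↦ isOpen_preimage_inl_of_mem_basis hp hU ht

/-- `inl : E → PunctureFill` is an open embedding. [folklore] -/
theorem isOpenEmbedding_inl (hp : Continuous p) (hU : ∀ i, IsOpen (U i)) :
    IsOpenEmbedding (inl p x₀ U) :=
  .of_continuous_injective_isOpenMap (continuous_inl hp hU) (inl_injective p x₀ U)
    fun _ hO ↦ isOpen_image_inl hO

omit [TopologicalSpace E] [TopologicalSpace X] in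
/-- The range of `inl` is the complement of the new points, i.e. `proj ⁻¹' {x₀}ᶜ` when `p` omits
`x₀`. [folklore] -/
theorem range_inl (hx : ∀ e, p e ≠ x₀) :
    range (inl p x₀ U) = proj p x₀ U ⁻¹' {x₀}ᶜ := by
  ext z
  rcases inl_or_inr p x₀ U z with ⟨e, rfl⟩ | ⟨i, rfl⟩
  · simpa using hx e
  · simp only [mem_range, mem_preimage, proj_inr, mem_compl_iff, mem_singleton_iff,
      not_true_eq_false, iff_false, not_exists]
    exact fun e ↦ inl_ne_inr p x₀ U e i

/-- `proj : PunctureFill → X` is continuous. [folklore] -/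
theorem continuous_proj (hp : Continuous p) : Continuous (proj p x₀ U) := by
  refine continuous_def.mpr fun O hO ↦ ?_
  by_cases h0 : x₀ ∈ O
  · -- `proj ⁻¹ O = inl (p ⁻¹ O) ∪ ⋃ᵢ cusp neighbourhoods`
    have : proj p x₀ U ⁻¹' O = inl p x₀ U '' (p ⁻¹' O) ∪
        ⋃ i, insert (inr p x₀ U i) (inl p x₀ U '' (U i ∩ p ⁻¹' O)) := by
      ext z
      rcases inl_or_inr p x₀ U z with ⟨e, rfl⟩ | ⟨i, rfl⟩
      · simp only [mem_preimage, proj_inl, mem_union, mem_iUnion, mem_insert_iff,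
          (inl_injective p x₀ U).mem_set_image]
        constructor
        · exact fun h ↦ Or.inl h
        · rintro (h | ⟨i, h | h⟩)
          · exact h
          · exact absurd h (inl_ne_inr p x₀ U e i)
          · exact h.2
      · simp only [mem_preimage, proj_inr, h0, true_iff, mem_union, mem_iUnion, mem_insert_iff]
        exact Or.inr ⟨i, Or.inl rfl⟩
    rw [this]
    exact (isOpen_image_inl (hO.preimage hp)).union (isOpen_iUnion fun i ↦ isOpen_cuspNhd i hO h0)
  · have : proj p x₀ U ⁻¹' O = inl p x₀ U '' (p ⁻¹' O) := by
      ext z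
      rcases inl_or_inr p x₀ U z with ⟨e, rfl⟩ | ⟨i, rfl⟩
      · simp [(inl_injective p x₀ U).mem_set_image]
      · simp only [mem_preimage, proj_inr, mem_image]
        exact ⟨fun h ↦ absurd h h0, fun ⟨e, _, he⟩ ↦ absurd he (inl_ne_inr p x₀ U e i)⟩
    rw [this]
    exact isOpen_image_inl (hO.preimage hp)


omit [TopologicalSpace E] [TopologicalSpace X] in
/-- The image of a cusp neighbourhood: `proj ({∞ᵢ} ∪ (U i ∩ p⁻¹ O)) = W ∩ O` when
`p (U i) = W ∖ {x₀}` and `x₀ ∈ W ∩ O`. [folklore] -/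
theorem image_proj_cuspNhd {W : Set X} (hx₀ : x₀ ∈ W) {i : ι} (himg : p '' U i = W \ {x₀})
    {O : Set X} (hO : x₀ ∈ O) :
    proj p x₀ U '' insert (inr p x₀ U i) (inl p x₀ U '' (U i ∩ p ⁻¹' O)) = W ∩ O := by
  rw [image_insert_eq, proj_inr, image_image]
  simp only [proj_inl]
  rw [image_inter_preimage, himg]
  ext w
  simp only [mem_insert_iff, mem_inter_iff, Set.mem_sdiff, mem_singleton_iff]
  constructor
  · rintro (rfl | ⟨⟨hw, -⟩, hw'⟩)
    · exact ⟨hx₀, hO⟩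
    · exact ⟨hw, hw'⟩
  · rintro ⟨hw, hw'⟩
    by_cases h : w = x₀
    · exact Or.inl h
    · exact Or.inr ⟨⟨hw, h⟩, hw'⟩

/-- **`proj` is an open map** when `p` is open and every sheet `U i` is mapped onto `W ∖ {x₀}`
for an open `W ∋ x₀`. [folklore] -/
theorem isOpenMap_proj (hp : Continuous p) (hopen : IsOpenMap p) (hU : ∀ i, IsOpen (U i))
    {W : Set X} (hW : IsOpen W) (hx₀ : x₀ ∈ W) (himg : ∀ i, p '' U i = W \ {x₀}) :
    IsOpenMap (proj p x₀ U) := by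
  intro S hS
  rw [isOpen_iff_mem_nhds]
  rintro _ ⟨z, hz, rfl⟩
  obtain ⟨t, ht, hzt, htS⟩ := (isOpen_iff hp hU).mp hS z hz
  refine mem_of_superset ?_ (image_mono htS)
  rcases ht with ⟨O, hO, rfl⟩ | ⟨i, O, hO, hO₀, rfl⟩
  · obtain ⟨e, he, rfl⟩ := hzt
    rw [image_image]
    simp only [proj_inl]
    exact (hopen O hO).mem_nhds ⟨e, he, rfl⟩
  · rw [image_proj_cuspNhd hx₀ (himg i) hO₀]
    refine (hW.inter hO).mem_nhds ?_
    rcases hzt with rfl | ⟨e, he, rfl⟩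
    · exact ⟨hx₀, hO₀⟩
    · have : p e ∈ W \ {x₀} := himg i ▸ ⟨e, he.1, rfl⟩
      exact ⟨this.1, he.2⟩

/-- The sheets `{∞ᵢ} ∪ U i` of `proj` over `W` are open. [folklore] -/
theorem isOpen_sheet (i : ι) : IsOpen (insert (inr p x₀ U i) (inl p x₀ U '' U i)) := by
  have := isOpen_cuspNhd (p := p) (x₀ := x₀) (U := U) i isOpen_univ (mem_univ x₀)
  rwa [preimage_univ, inter_univ] at this

/-- **`x₀` (indeed all of `W`) is evenly covered by `proj`, with fibre the set of sheets `ι`.**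
[folklore] -/
theorem isEvenlyCovered_proj [Nonempty ι] (hx : ∀ e, p e ≠ x₀) (hp : Continuous p)
    (hopen : IsOpenMap p) (hU : ∀ i, IsOpen (U i)) (hdisj : Pairwise (Disjoint on U))
    {W : Set X} (hW : IsOpen W) (hx₀ : x₀ ∈ W) (himg : ∀ i, p '' U i = W \ {x₀})
    (hinj : ∀ i, InjOn p (U i)) (hexh : p ⁻¹' W ⊆ ⋃ i, U i) {x : X} (hxW : x ∈ W) :
    IsEvenlyCovered (proj p x₀ U) x (proj p x₀ U ⁻¹' {x}) := by
  letI : TopologicalSpace ι := ⊥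
  haveI : DiscreteTopology ι := ⟨rfl⟩
  haveI : Nonempty (X → PunctureFill p x₀ U) := ⟨fun _ ↦ inr p x₀ U (Classical.arbitrary ι)⟩
  have hO := isOpenMap_proj hp hopen hU hW hx₀ himg
  -- the trivialization over `W` with sheets `{∞ᵢ} ∪ U i`
  let t : Trivialization ι (proj p x₀ U) :=
    hW.trivializationDiscrete (fun i ↦ insert (inr p x₀ U i) (inl p x₀ U '' U i)) W
      (fun i {W'} hW' ↦ ⟨fun h ↦ (h.preimage (continuous_proj hp)).inter (isOpen_sheet i),
        fun h ↦ ?_⟩) (fun i ↦ ?_) (fun i ↦ ?_) ?_ ?_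
  · exact (IsEvenlyCovered.of_trivialization (t := t) (by
      rw [IsOpen.trivializationDiscrete_baseSet]; exact hxW)).to_isEvenlyCovered_preimage
  · -- openness of `W'` from openness of `proj ⁻¹ W' ∩ sheet`
    have heq : W' = proj p x₀ U '' (proj p x₀ U ⁻¹' W' ∩
        insert (inr p x₀ U i) (inl p x₀ U '' U i)) := by
      refine Subset.antisymm (fun w hw ↦ ?_) ?_
      · by_cases hw₀ : w = x₀
        · exact ⟨inr p x₀ U i, ⟨by rw [mem_preimage, proj_inr, ← hw₀]; exact hw, mem_insert _ _⟩,
            by rw [proj_inr, hw₀]⟩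
        · have : w ∈ p '' U i := by rw [himg i]; exact ⟨hW' hw, hw₀⟩
          obtain ⟨e, he, rfl⟩ := this
          exact ⟨inl p x₀ U e, ⟨hw, mem_insert_of_mem _ ⟨e, he, rfl⟩⟩, rfl⟩
      · rintro _ ⟨z, ⟨hz, -⟩, rfl⟩
        exact hz
    rw [heq]
    exact hO _ h
  · -- injectivity on a sheet
    rintro z hz z' hz' hzz'
    rcases hz with rfl | ⟨e, he, rfl⟩ <;> rcases hz' with rfl | ⟨e', he', rfl⟩
    · rfl
    · exact absurd (by simpa using hzz'.symm) (hx e')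
    · exact absurd (by simpa using hzz') (hx e)
    · simp only [proj_inl] at hzz'
      rw [hinj i he he' hzz']
  · -- surjectivity of a sheet onto `W`
    intro w hw
    by_cases hw₀ : w = x₀
    · exact ⟨inr p x₀ U i, mem_insert _ _, by rw [proj_inr, hw₀]⟩
    · have : w ∈ p '' U i := by rw [himg i]; exact ⟨hw, hw₀⟩
      obtain ⟨e, he, rfl⟩ := this
      exact ⟨inl p x₀ U e, mem_insert_of_mem _ ⟨e, he, rfl⟩, rfl⟩
  · -- the sheets are pairwise disjoint
    intro i j hij
    refine disjoint_left.mpr fun z hz hz' ↦ ?_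
    rcases hz with rfl | ⟨e, he, rfl⟩
    · rcases hz' with h | ⟨e', -, h⟩
      · exact hij ((inr_injective p x₀ U) h)
      · exact inl_ne_inr p x₀ U e' i h
    · rcases hz' with h | ⟨e', he', h⟩
      · exact inl_ne_inr p x₀ U e j h
      · rw [(inl_injective p x₀ U) h] at he'
        exact disjoint_left.mp (hdisj hij) he he'
  · -- the sheets exhaust `proj ⁻¹ W`
    intro z hz
    rcases inl_or_inr p x₀ U z with ⟨e, rfl⟩ | ⟨i, rfl⟩
    · rw [mem_preimage, proj_inl] at hz
      obtain ⟨i, hi⟩ := mem_iUnion.mp (hexh hz)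
      exact mem_iUnion.mpr ⟨i, mem_insert_of_mem _ ⟨e, hi, rfl⟩⟩
    · exact mem_iUnion.mpr ⟨i, mem_insert _ _⟩

/-- **Away from `x₀`, `proj` is the covering `p`** (transported along the open embedding `inl`).
[folklore] -/
theorem isCoveringMapOn_proj_compl [T1Space X] (hx : ∀ e, p e ≠ x₀) (hp : Continuous p)
    (hU : ∀ i, IsOpen (U i)) (hcov : IsCoveringMapOn p {x₀}ᶜ) :
    IsCoveringMapOn (proj p x₀ U) {x₀}ᶜ := by
  have hemb := isOpenEmbedding_inl (p := p) (x₀ := x₀) (U := U) hp hU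
  have hrange := range_inl (p := p) (x₀ := x₀) (U := U) hx
  have huniv : p ⁻¹' {x₀}ᶜ = univ := eq_univ_of_forall fun e ↦ hx e
  have h1 : IsCoveringMap (({x₀}ᶜ : Set X).restrictPreimage p) := hcov.isCoveringMap_restrictPreimage
  -- `p ⁻¹ {x₀}ᶜ = E ≃ₜ range inl = proj ⁻¹ {x₀}ᶜ`
  let ψ : (p ⁻¹' {x₀}ᶜ) ≃ₜ (proj p x₀ U ⁻¹' {x₀}ᶜ) :=
    ((Homeomorph.setCongr huniv).trans (Homeomorph.Set.univ E)).trans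
      (hemb.isEmbedding.toHomeomorph.trans (Homeomorph.setCongr hrange))
  have hcomp : (({x₀}ᶜ : Set X).restrictPreimage (proj p x₀ U)) ∘ ψ =
      ({x₀}ᶜ : Set X).restrictPreimage p := by
    funext e
    rfl
  have h2 : IsCoveringMap (({x₀}ᶜ : Set X).restrictPreimage (proj p x₀ U)) := by
    rw [← IsCoveringMap.comp_homeomorph_iff ψ, hcomp]
    exact h1
  refine IsCoveringMapOn.of_isCoveringMap_restrictPreimage (s := ({x₀}ᶜ : Set X))
    (f := proj p x₀ U) isOpen_compl_singleton ?_ h2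
  rw [← hrange]
  exact hemb.isOpen_range

/-- **Filling the puncture of a covering.** Let `p : E → X` be a covering map over `X ∖ {x₀}`
omitting `x₀`, and suppose `x₀` has an open neighbourhood `W` over which `p` is "evenly covered
with a puncture": `p ⁻¹ W` is the disjoint union of open sheets `U i`, each mapped by `p`
bijectively onto `W ∖ {x₀}`. Then `proj : PunctureFill p x₀ U → X` — `p` with one point `∞ᵢ ↦ x₀`
added at the end of each sheet — is a covering map. (The situation of a cusp of width one of a
modular curve over the punctured disc, or of `z ↦ z` near a removable puncture.) [folklore] -/
theorem isCoveringMap_proj [T1Space X] [Nonempty ι] (hx : ∀ e, p e ≠ x₀) (hcov : IsCoveringMapOn p {x₀}ᶜ)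
    (hU : ∀ i, IsOpen (U i)) (hdisj : Pairwise (Disjoint on U)) {W : Set X} (hW : IsOpen W)
    (hx₀ : x₀ ∈ W) (himg : ∀ i, p '' U i = W \ {x₀}) (hinj : ∀ i, InjOn p (U i))
    (hexh : p ⁻¹' W ⊆ ⋃ i, U i) : IsCoveringMap (proj p x₀ U) := by
  have huniv : p ⁻¹' {x₀}ᶜ = univ := eq_univ_of_forall fun e ↦ hx e
  have hp : Continuous p := by
    rw [← continuousOn_univ, ← huniv]
    exact hcov.continuousOn
  have hloc : IsLocalHomeomorph p := by
    rw [isLocalHomeomorph_iff_isLocalHomeomorphOn_univ, ← huniv]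
    exact hcov.isLocalHomeomorphOn
  have hopen : IsOpenMap p := hloc.isOpenMap
  intro x
  by_cases hxx : x = x₀
  · subst hxx
    exact isEvenlyCovered_proj hx hp hopen hU hdisj hW hx₀ himg hinj hexh hx₀
  · exact isCoveringMapOn_proj_compl hx hp hU hcov x hxx

/-! ### Neighbourhoods of the new points -/

/-- The cusp neighbourhoods `{∞ᵢ} ∪ (U i ∩ p⁻¹ O)`, `O` an open neighbourhood of `x₀`, form a
basis of neighbourhoods of `∞ᵢ`. [folklore] -/
theorem nhds_inr_hasBasis (hp : Continuous p) (hU : ∀ i, IsOpen (U i)) (i : ι) :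
    (𝓝 (inr p x₀ U i)).HasBasis (fun O : Set X ↦ IsOpen O ∧ x₀ ∈ O)
      fun O ↦ insert (inr p x₀ U i) (inl p x₀ U '' (U i ∩ p ⁻¹' O)) := by
  refine ⟨fun s ↦ ⟨fun hs ↦ ?_, ?_⟩⟩
  · obtain ⟨t, ht, hit, hts⟩ := (isTopologicalBasis hp hU).mem_nhds_iff.mp hs
    rcases ht with ⟨O, hO, rfl⟩ | ⟨j, O, hO, hO₀, rfl⟩
    · obtain ⟨e, -, he⟩ := hit
      exact absurd he (inl_ne_inr p x₀ U e i)
    · have hij : i = j := by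
        rcases hit with h | ⟨e, -, he⟩
        · exact inr_injective p x₀ U h
        · exact absurd he (inl_ne_inr p x₀ U e i)
      subst hij
      exact ⟨O, ⟨hO, hO₀⟩, hts⟩
  · rintro ⟨O, ⟨hO, hO₀⟩, hOs⟩
    exact mem_of_superset ((isOpen_cuspNhd i hO hO₀).mem_nhds (mem_insert _ _)) hOs

/-- **Continuity at a new point.** A map `g` out of the filled space is continuous at `∞ᵢ` iff
`g ∘ inl`, restricted to the sheet `U i`, tends to `g ∞ᵢ` as `p e → x₀`. [folklore] -/
theorem continuousAt_inr_iff (hp : Continuous p) (hU : ∀ i, IsOpen (U i)) {Y : Type*}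
    [TopologicalSpace Y] {g : PunctureFill p x₀ U → Y} (i : ι) :
    ContinuousAt g (inr p x₀ U i) ↔
      Tendsto (fun e ↦ g (inl p x₀ U e)) (comap p (𝓝 x₀) ⊓ 𝓟 (U i)) (𝓝 (g (inr p x₀ U i))) := by
  rw [ContinuousAt, (nhds_inr_hasBasis hp hU i).tendsto_left_iff,
    ((((nhds_basis_opens x₀).comap p).inf_principal (U i)).tendsto_left_iff)]
  refine forall₂_congr fun s hs ↦ ⟨?_, ?_⟩
  · rintro ⟨O, ⟨hO, hO₀⟩, hOs⟩
    refine ⟨O, ⟨hO₀, hO⟩, fun e he ↦ hOs (mem_insert_of_mem _ ⟨e, ⟨he.2, he.1⟩, rfl⟩)⟩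
  · rintro ⟨O, ⟨hO₀, hO⟩, hOs⟩
    refine ⟨O, ⟨hO, hO₀⟩, ?_⟩
    rintro z (rfl | ⟨e, he, rfl⟩)
    · exact mem_of_mem_nhds hs
    · exact hOs ⟨he.2, he.1⟩

end PunctureFill

end Literature.Topology.CoveringSpaces
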